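import Literature.MathematicalPhysics.QuantumFieldTheory.Balaban1983to89.B5Eq129FreeResolventWeightedGradientRowOperator
import Literature.MathematicalPhysics.QuantumFieldTheory.Balaban1983to89.B5Eq129FreeResolventGradientRowSites

/-!
# `Balaban1983to89.B5Eq129FreeResolventWeightedAdjointRow` — T. Bałaban, *Propagators and renormalization transformations for lattice gauge
# theories. I*, Commun. Math. Phys. **95** (1984) 17–40 [Balaban1984PropagatorsI] (1.29) p. 23 (free lattice operators on the finite torus), p. 36 (the
# `cosh` weights), serving [Balaban1985BackgroundPropagators] Thm 3.1 (3.42) p. 397, THIRD ENTRY `|(G′(U)∇*_Uλ)(x)|`, FLAT CASE: **THE WEIGHTED ADJOINT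
# (DIVERGENCE) ROW OF THE FREE MASSIVE RESOLVENT IN SOLUTION SHAPE — if `(L₀ + m)u = ∂*f := t·Σ_ν(f_ν(· − e_ν) − f_ν)` on a finite torus and
# `‖f_ν(y)‖ ≤ F·W_c(y)`, then `‖u(x)‖ ≤ t·(Σ_ν B_ν)·F·W_c(x)` with leaf-05's constants `B_ν` of the weighted ∇-row** — by TRANSLATION INVARIANCE of the
# free Green's function (`G(x, y + e_ν) = G(x − e_ν, y)`) and summation by parts on the torus, the adjoint row IS the ∇-row
# (`B5Eq129FreeResolventWeightedGradientRowOperator.sum_weight_mul_abs_green_sub_le`) read against shifted data; on b05's `Tor N` (§1) and on the chain's periodic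
# lattice `TSite d P` with `shift`∕`unshift` and bond data `f : Bond d P → V` (§2)

statement-level skeleton of published theorems with citation tags; proofs where landed; nothing here is a claim about the Yang–Mills mass gap

CITATION HEADER (lean-in-tree rule).  Audit cell `pub-balaban`, sub-cell `t4`, BINDER row NE9; filed by NE9 crux-team LEAF PROVER 01
(`b2b-balaban-t4-ne9-formalise-leaf-01`, gen 93; bears_on: R4/N22).  OBJECT: [Balaban1984PropagatorsI] (1.29) p. 23's free stencil in the encoding of
`B5Eq129FreeResolventSupBound` ∕ `B5Eq129FreeResolventGradientRow` (`Tor N`, `unitVec`; the resolvent equation as a hypothesis; no `def`), the product-`cosh`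
weight of p. 36 as written by NE9 leaf-05 (`B5Eq129FreeResolventWeightedGradientRowOperator`).  CONTENT: [folklore] composition BY NAME — the Green's function
(`exists_green`, `apply_eq_sum_green_smul`), its translation invariance (`green_eq_kernel_sub`) and the weighted ∇-row of the kernel (`sum_weight_mul_abs_green_sub_le`);
the site dictionary `TSite d P → Tor P` of `B9Eq315FlatDictionary` (pattern of leaf-05's `B5Eq129FreeResolventGradientRowSites.gradRow_tsite_of_tor`).  Nothing of
print is asserted.

WHY THIS FILE (cell context).  STOREY H of the lineage's (117) programme rests on two printed Hölder members of [B9] Thm 3.1 for `G′_k(U)` on the model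
(`B9Eq3152StoreyHTwoHolderMembers`: (HLa₀) = (3.43)₂ + the VALUE row of `G′_kD*_U`, (HLb) = (3.44)).  The value row of `G′_kD*_U` (Thm 3.1 (3.42), third entry) is
reached on the model by perturbing the covariant massive resolvent `(Δ^η_U + m)⁻¹D*_U` around `U = 1`; its one flat input is THIS letter: the adjoint row of
`(L₀ + m)⁻¹∂*` with the `cosh` weights (decay).  No Fourier analysis, no kernel asymptotics: in the flat, translation-invariant case `(L₀+m)⁻¹∂*_ν = −τ_{−e_ν}∂_ν(L₀+m)⁻¹`,
so leaf-05's weighted ∇-row of the KERNEL is the adjoint row verbatim.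

WHAT IS PROVED (sorry-free; proof lane — 0 `def`).
* §1 (on `Tor N`) **`sum_green_smul_div_eq`** — summation by parts + translation invariance: `Σ_y G(x,y)•(f(y − e_ν) − f(y)) = Σ_y (G(x − e_ν, y) − G(x, y))•f(y)`;
  **`norm_apply_le_of_resolvent_div_weighted`** — `(L₀+m)u = t•Σ_ν(f_ν(· − e_ν) − f_ν)`, `‖f_ν(y)‖ ≤ F·W_c(y)` (every `ν`, `y`), `N_ν ≥ 2`, the window
  `2d·t²(cosh a − 1) < m` ⟹ `‖u(x)‖ ≤ t·(Σ_ν B_ν)·F·W_c(x)`.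
* §2 (on `TSite d P`) **`norm_apply_le_of_resolvent_covDiv_weighted`** — the same letter for the chain's lattice: equation written with `unshift`∕`shift`, data a bond
  function `f : Bond d P → V` entering through the FLAT divergence `t•Σ_ν(f(unshift ν x, ν) − f(x, ν))` (= `B9Eq33CovDerivVector.covDiv t (fun _ ↦ id) f x`), weight
  centred at a site `x₀`, data bound read at the bond's base point `bpos`.
HONEST SCOPE.  FLAT (`U = 1`) stencil only; constants leaf-05's (per direction, with the finite-period factor `1 + 2t∕(N_ν√μ)`); in the chain's units `t = η⁻¹`, `a = κη`,
`m = O(1)` the letter is height-free (`t·B_ν = O(1)`).  ONE flat input of ONE sub-row (the value member of (HLa₀)) behind STOREY H; NOT a letter of (3.42) for `G′_k(U)`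
by itself; NOT Tier P, NOT NE9 (cell pub-balaban: NE9 NOT PRINTED ∕ NOT PROVED; «NE9 ⇐ the named binders»; row WALLED ON A MODEL (O-NE9-1; #5 UNRULED); spine PROVED
0∕9; rung (B)+1 finite T⁴ — NOT infinite volume, NOT mass gap, NOT BetaPertH, NOT Clay).  HONEST DEPENDENCY: continuum YM on T⁴ ⇐ BetaPertH ∧ nine spine estimates
(0/9 proved); BetaPertH ⇐ (D1) ∧ (D4) ∧ CAP+tail; G-an2-4 gates asym, D1 and NE2/3/4.  NEW file importing the two files named; nothing modified.  Net new unproved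
facts: 0.
-/

noncomputable section

open scoped BigOperators

namespace Literature.MathematicalPhysics.QuantumFieldTheory.Balaban1983to89.B5Eq129FreeResolventWeightedAdjointRow

open B5Prop11Plancherel (Tor unitVec)
open B4TorusKernel.MultiPeriod (circAbs)
open B4Sect5Torus (TSite)
open B9SectCLatticeCarrier (Bond bpos shift unshift)
open B5Eq129FreeResolventGradientRow (exists_green apply_eq_sum_green_smul)
open B5Eq129FreeResolventWeightedGradientRowOperator (green_eq_kernel_sub sum_weight_mul_abs_green_sub_le)
open B9Eq315FlatDictionary (torCast_bijective torCast_shift torCast_unshift)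

/-! ## §1 The adjoint row on b05's torus `Tor N` -/

section Tor

variable {d : ℕ} (N : Fin d → ℕ) [∀ μ, NeZero (N μ)]

/-- **SUMMATION BY PARTS + TRANSLATION INVARIANCE**: for a Green's function `G` of `L₀ + m` (`(L₀+m)G(·,y) = δ_y` for every `y`) and vector-valued data `f`,
`Σ_y G(x,y)•(f(y − e_ν) − f(y)) = Σ_y (G(x − e_ν, y) − G(x, y))•f(y)` — reindex `y ↦ y + e_ν` in the first sum and use `G(x, y + e_ν) = G(x − e_ν, y)`
(`green_eq_kernel_sub`: `G(z, y) = G(z − y, 0)`). [folklore] [cite: Balaban1984PropagatorsI, (1.29) p.23] -/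
theorem sum_green_smul_div_eq {V : Type*} [NormedAddCommGroup V] [NormedSpace ℝ V] (t : ℝ) {m : ℝ} (hm : 0 < m)
    {G : Tor N → Tor N → ℝ}
    (hG : ∀ y x, ∑ ν, t ^ 2 * ((G x y - G (x - unitVec N ν) y) + (G x y - G (x + unitVec N ν) y)) + m * G x y =
      if x = y then 1 else 0)
    (f : Tor N → V) (ν : Fin d) (x : Tor N) :
    ∑ y, G x y • (f (y - unitVec N ν) - f y) = ∑ y, (G (x - unitVec N ν) y - G x y) • f y := by
  classical
  have htr : ∀ y z, G z y = G (z - y) 0 := green_eq_kernel_sub N t hm hG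
  have hshift : ∀ y, G x (y + unitVec N ν) = G (x - unitVec N ν) y := fun y => by
    rw [htr (y + unitVec N ν) x, htr y (x - unitVec N ν)]
    congr 1
    abel
  have hre : ∑ y, G x y • f (y - unitVec N ν) = ∑ y, G x (y + unitVec N ν) • f y := by
    refine (Fintype.sum_equiv (Equiv.subRight (unitVec N ν)) _ _ fun y => ?_)
    simp only [Equiv.subRight_apply, sub_add_cancel]
  simp only [smul_sub, Finset.sum_sub_distrib, hre, hshift, sub_smul]

/-- **THE WEIGHTED ADJOINT ROW OF THE FREE MASSIVE RESOLVENT IN SOLUTION SHAPE** (`Tor N`).  In leaf-05's window `2d·t²(cosh a − 1) < m` (`t > 0`, `a ≥ 0`,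
`N_ν ≥ 2` for every `ν`): if `(L₀ + m)u = t•Σ_ν(f_ν(· − e_ν) − f_ν)` (the flat divergence of the bond data `f`) and `‖f_ν(y)‖ ≤ F·W_c(y)` for all `y`, `ν`, then
at every site `‖u(x)‖ ≤ t·(Σ_ν B_ν)·F·W_c(x)`, `B_ν` the constant of `sum_weight_mul_abs_green_sub_le`.  Proof: `u(x) = Σ_yG(x,y)•(∂*f)(y)` (`apply_eq_sum_green_smul`),
`sum_green_smul_div_eq`, and the weighted ∇-row of the kernel. [folklore]
[cite: Balaban1984PropagatorsI, (1.29) p.23, p.36; Balaban1985BackgroundPropagators, Thm 3.1 (3.42) p.397] -/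
theorem norm_apply_le_of_resolvent_div_weighted {V : Type*} [NormedAddCommGroup V] [NormedSpace ℝ V] (t : ℝ) (ht : 0 < t) {m a : ℝ}
    (hm : 0 < m) (ha : 0 ≤ a) (hlam : 2 * (d : ℝ) * t ^ 2 * (Real.cosh a - 1) < m) (hn : ∀ ν, 2 ≤ N ν)
    {u : Tor N → V} {f : Tor N → Fin d → V}
    (hu : ∀ x, ∑ ν, t ^ 2 • ((u x - u (x - unitVec N ν)) + (u x - u (x + unitVec N ν))) + m • u x =
      t • ∑ ν, (f (x - unitVec N ν) ν - f x ν))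
    (c : Tor N) {F : ℝ} (hf : ∀ y ν, ‖f y ν‖ ≤ F * ∏ μ, Real.cosh (a * (circAbs (N μ) ((c μ - y μ : ZMod (N μ)).val) : ℝ)))
    (x : Tor N) :
    ‖u x‖ ≤ t * (∑ ν : Fin d, ((1 + Real.exp (-a)) * ((1 + 2 * t / (N ν * Real.sqrt (m - 2 * ((d : ℝ) - 1) * t ^ 2 * (Real.cosh a - 1)))) /
            Real.sqrt ((m - 2 * ((d : ℝ) - 1) * t ^ 2 * (Real.cosh a - 1)) ^ 2 + 4 * (m - 2 * ((d : ℝ) - 1) * t ^ 2 * (Real.cosh a - 1)) * t ^ 2)) +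
          2 * Real.sinh a / (m - 2 * (d : ℝ) * t ^ 2 * (Real.cosh a - 1)))) *
        F * ∏ μ, Real.cosh (a * (circAbs (N μ) ((c μ - x μ : ZMod (N μ)).val) : ℝ)) := by
  classical
  obtain ⟨G, hG⟩ := exists_green N t hm
  set W : Tor N → ℝ := fun y => ∏ μ, Real.cosh (a * (circAbs (N μ) ((c μ - y μ : ZMod (N μ)).val) : ℝ)) with hWdef
  set B : Fin d → ℝ := fun ν => (1 + Real.exp (-a)) * ((1 + 2 * t / (N ν * Real.sqrt (m - 2 * ((d : ℝ) - 1) * t ^ 2 * (Real.cosh a - 1)))) /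
            Real.sqrt ((m - 2 * ((d : ℝ) - 1) * t ^ 2 * (Real.cosh a - 1)) ^ 2 + 4 * (m - 2 * ((d : ℝ) - 1) * t ^ 2 * (Real.cosh a - 1)) * t ^ 2)) +
          2 * Real.sinh a / (m - 2 * (d : ℝ) * t ^ 2 * (Real.cosh a - 1)) with hBdef
  have hW0 : ∀ y, 0 < W y := fun y => Finset.prod_pos fun _ _ => Real.cosh_pos _
  -- `u x = t • Σ_ν Σ_y (G(x − e_ν, y) − G(x, y)) • f y ν`
  have hux : u x = t • ∑ ν, ∑ y, (G (x - unitVec N ν) y - G x y) • f y ν := by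
    rw [apply_eq_sum_green_smul N t hm hG hu x]
    calc ∑ y, G x y • (t • ∑ ν, (f (y - unitVec N ν) ν - f y ν))
        = t • ∑ y, ∑ ν, G x y • (f (y - unitVec N ν) ν - f y ν) := by
          rw [Finset.smul_sum]
          refine Finset.sum_congr rfl fun y _ => ?_
          rw [smul_comm, Finset.smul_sum]
      _ = t • ∑ ν, ∑ y, G x y • (f (y - unitVec N ν) ν - f y ν) := by rw [Finset.sum_comm]
      _ = t • ∑ ν, ∑ y, (G (x - unitVec N ν) y - G x y) • f y ν := by
          congr 1
          exact Finset.sum_congr rfl fun ν _ => sum_green_smul_div_eq N t hm hG (fun y => f y ν) ν x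
  -- each direction: the weighted ∇-row of the kernel against the data
  have hdir : ∀ ν, ‖∑ y, (G (x - unitVec N ν) y - G x y) • f y ν‖ ≤ B ν * F * W x := by
    intro ν
    by_cases hF : 0 ≤ F
    · calc ‖∑ y, (G (x - unitVec N ν) y - G x y) • f y ν‖
          ≤ ∑ y, ‖(G (x - unitVec N ν) y - G x y) • f y ν‖ := norm_sum_le _ _
        _ ≤ ∑ y, W y * |G (x - unitVec N ν) y - G x y| * F := Finset.sum_le_sum fun y _ => by
            rw [norm_smul, Real.norm_eq_abs]
            have h := mul_le_mul_of_nonneg_left (hf y ν) (abs_nonneg (G (x - unitVec N ν) y - G x y))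
            calc |G (x - unitVec N ν) y - G x y| * ‖f y ν‖ ≤ |G (x - unitVec N ν) y - G x y| * (F * W y) := h
              _ = W y * |G (x - unitVec N ν) y - G x y| * F := by ring
        _ = (∑ y, W y * |G (x - unitVec N ν) y - G x y|) * F := by rw [Finset.sum_mul]
        _ ≤ (B ν * W x) * F := mul_le_mul_of_nonneg_right (sum_weight_mul_abs_green_sub_le N t ht hm ha hlam hG ν (hn ν) c x) hF
        _ = B ν * F * W x := by ring
    · -- `F < 0` is impossible unless there is no site-direction datum; but `f x ν` exists: `‖f x ν‖ ≤ F·W < 0` is absurd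
      exfalso
      have h := hf x ν
      have : F * W x < 0 := mul_neg_of_neg_of_pos (lt_of_not_ge hF) (hW0 x)
      linarith [norm_nonneg (f x ν)]
  rw [hux, norm_smul, Real.norm_eq_abs, abs_of_pos ht]
  calc t * ‖∑ ν, ∑ y, (G (x - unitVec N ν) y - G x y) • f y ν‖
      ≤ t * ∑ ν, ‖∑ y, (G (x - unitVec N ν) y - G x y) • f y ν‖ := mul_le_mul_of_nonneg_left (norm_sum_le _ _) ht.le
    _ ≤ t * ∑ ν, B ν * F * W x := mul_le_mul_of_nonneg_left (Finset.sum_le_sum fun ν _ => hdir ν) ht.le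
    _ = t * (∑ ν, B ν) * F * W x := by rw [← Finset.sum_mul, ← Finset.sum_mul]; ring

end Tor

/-! ## §2 The adjoint row on the chain's periodic lattice `TSite d P` (bond data, `shift`∕`unshift`) -/

section TSite

variable {d : ℕ} (P : Fin d → ℕ) [∀ i, NeZero (P i)]

/-- **THE WEIGHTED ADJOINT ROW OF THE FREE MASSIVE RESOLVENT ON `TSite d P`, SOLUTION SHAPE.**  In the window `2d·t²(cosh a − 1) < m` (`t > 0`, `a ≥ 0`,
`P_ν ≥ 2`): every solution of `Σ_ν t²•((u x − u(unshift ν x)) + (u x − u(shift ν x))) + m•u x = t•Σ_ν (f(unshift ν x, ν) − f(x, ν))` — `(L₀+m)u = ∂*f` with the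
FLAT divergence of the bond function `f : Bond d P → V` (`B9Eq33CovDerivVector.covDiv t (fun _ ↦ id)`) — whose data obey `‖f(b)‖ ≤ F·W_{x₀}(b₋)` (`b₋ = bpos b`, the
product-`cosh` weight centred at the site `x₀`) satisfies `‖u(x)‖ ≤ t·(Σ_ν B_ν)·F·W_{x₀}(x)` — §1 transported along the site dictionary `x ↦ (x_μ mod P_μ)_μ`
(`torCast_bijective`, `torCast_shift`, `torCast_unshift`). [folklore]
[cite: Balaban1984PropagatorsI, (1.29) p.23, p.36; Balaban1985BackgroundPropagators, (3.8) p.392, Thm 3.1 (3.42) p.397] -/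
theorem norm_apply_le_of_resolvent_covDiv_weighted {V : Type*} [NormedAddCommGroup V] [NormedSpace ℝ V] (t : ℝ) (ht : 0 < t) {m a : ℝ}
    (hm : 0 < m) (ha : 0 ≤ a) (hlam : 2 * (d : ℝ) * t ^ 2 * (Real.cosh a - 1) < m) (hn : ∀ ν, 2 ≤ P ν)
    {u : TSite d P → V} {f : Bond d P → V}
    (hu : ∀ x, ∑ ν, t ^ 2 • ((u x - u (unshift ν x)) + (u x - u (shift ν x))) + m • u x = t • ∑ ν, (f (unshift ν x, ν) - f (x, ν)))
    (x₀ : TSite d P) {F : ℝ}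
    (hf : ∀ b : Bond d P, ‖f b‖ ≤ F * ∏ μ, Real.cosh (a * (circAbs (P μ) ((((x₀ μ : ℕ) : ZMod (P μ)) - ((bpos b μ : ℕ) : ZMod (P μ))).val) : ℝ)))
    (x : TSite d P) :
    ‖u x‖ ≤ t * (∑ ν : Fin d, ((1 + Real.exp (-a)) * ((1 + 2 * t / (P ν * Real.sqrt (m - 2 * ((d : ℝ) - 1) * t ^ 2 * (Real.cosh a - 1)))) /
            Real.sqrt ((m - 2 * ((d : ℝ) - 1) * t ^ 2 * (Real.cosh a - 1)) ^ 2 + 4 * (m - 2 * ((d : ℝ) - 1) * t ^ 2 * (Real.cosh a - 1)) * t ^ 2)) +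
          2 * Real.sinh a / (m - 2 * (d : ℝ) * t ^ 2 * (Real.cosh a - 1)))) *
        F * ∏ μ, Real.cosh (a * (circAbs (P μ) ((((x₀ μ : ℕ) : ZMod (P μ)) - ((x μ : ℕ) : ZMod (P μ))).val) : ℝ)) := by
  set e : TSite d P ≃ Tor P := Equiv.ofBijective _ (torCast_bijective P) with he
  have hsh : ∀ κ (y : TSite d P), e (shift κ y) = e y + unitVec P κ := fun κ y => torCast_shift P κ y
  have hush : ∀ κ (y : TSite d P), e (unshift κ y) = e y - unitVec P κ := fun κ y => torCast_unshift P κ y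
  have hsh' : ∀ κ (z : Tor P), e.symm (z + unitVec P κ) = shift κ (e.symm z) := fun κ z =>
    e.injective (by rw [Equiv.apply_symm_apply, hsh, Equiv.apply_symm_apply])
  have hush' : ∀ κ (z : Tor P), e.symm (z - unitVec P κ) = unshift κ (e.symm z) := fun κ z =>
    e.injective (by rw [Equiv.apply_symm_apply, hush, Equiv.apply_symm_apply])
  have heμ : ∀ (y : TSite d P) (μ : Fin d), e y μ = ((y μ : ℕ) : ZMod (P μ)) := fun y μ => rfl
  have hsymm : ∀ (z : Tor P) (μ : Fin d), (((e.symm z) μ : ℕ) : ZMod (P μ)) = z μ := fun z μ => by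
    rw [← heμ, Equiv.apply_symm_apply]
  have H := norm_apply_le_of_resolvent_div_weighted P t ht hm ha hlam hn (u := fun z => u (e.symm z)) (f := fun z ν => f (e.symm z, ν))
    (fun z => by simp only [hsh', hush']; exact hu _) (e x₀) (F := F)
    (fun z ν => by
      have h := hf (e.symm z, ν)
      simp only [bpos, hsymm] at h
      exact h)
    (e x)
  simp only [Equiv.symm_apply_apply] at H
  exact H

end TSite

end Literature.MathematicalPhysics.QuantumFieldTheory.Balaban1983to89.B5Eq129FreeResolventWeightedAdjointRow

end
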